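import Summits.BirchSwinnertonDyer.BirchSwinnertonDyer.Theorems.SignedLowerHalvesSprungLowerDivisibilityAtThreeKeyingDoor
import Summits.BirchSwinnertonDyer.BirchSwinnertonDyer.Theorems.SignedLowerHalvesSprungLowerDivisibilityAtThreeKatoSporadicLedger
import Summits.BirchSwinnertonDyer.BirchSwinnertonDyer.Theorems.SignedLowerHalvesSprungLowerDivisibilityAtThreeIotaSharpRow
import Summits.BirchSwinnertonDyer.BirchSwinnertonDyer.Theorems.SignedLowerHalvesSprungLowerDivisibilityAtThreeBothColours
import HarnessLib

/-!
# Crux `SprungLowerDivisibilityAtThree` (stmt-BirchSwinnertonDyer-19875, K1), line `chromatic-common-zeros` —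
# FACT-FREE PER-PAIR NEGATIVE: the typed leaf `Theorems.SprungSharpFlatLowerDivisibility W p •` fails at any pair
# carrying ONE contragredient dual with Kato's print divisibility and ONE `ι`-UNPAIRED zero of `L^•` off `(p)`

Width seat `cruxlead-stmt-BirchSwinnertonDyer-19875-w3` gen 8 (prover; D-0154 KEY (146)/(147)(a) row 8; host
`pub/bsd-ssimc`). THEOREMS ONLY — no definition, no named fact, no `instance`, no `sorry`; route-independent (no
`Theses` import); closes no item. It is NOT a refutation of anything: every theorem here is an implication whose
hypotheses (a dual datum with a stated property, a prime with stated memberships) are displayed binders that the tree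
does not construct. **BSD is NOT proved; K1 is neither proved nor refuted; nothing about nature is asserted.**

## What (sharpening the LEAD g5 negative lemma `…FalseOfKeyedSharpPrivateZero`, p660336, with the dictionary)

KEYING-g5 §2 (LEAD g5) derived «typed K1(♯) ⟹ `L♯` has no private sporadic zero» through a hypothesis package
H = (i) a γ-keyed `D` f.g. torsion ∧ (ii) a γ⁻¹-keyed `D′` f.g. torsion with `pⁿL♯ ∈ char D′.X` ∧ (iii) the
dictionary `ℓ_𝔭 D.X = ℓ_{ι𝔭} D′.X` ∧ (iv) a private sporadic zero. With the landed dictionary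
(`Sprung2012/SharpFlatSelmerDualInvolutionTwistProofs`, p660895) and the keying door (`…KeyingDoor`, p661746) the
chain runs through IDEALS instead of lengths, and (i), (iii), the finiteness/torsion clauses of (ii) and two of the
three excluded primes of (iv) drop out:

* §1 (pure `Λ`-algebra) `invol_mem_of_generatorShape_of_pow_mul_mem`: if `I = (gen)` with
  `gen^ℚ = C ϖ · (ι L · h)^ℚ` (`ϖ ∈ ℚ`, the door's contragredient shape) and `pⁿ L ∈ I`, then at every prime
  `𝔭 ∌ p`: `L ∈ 𝔭 ⟹ ι L ∈ 𝔭`. (Write `ϖ = a/b`; then `b pⁿ L = a · ιL · h · q` in `Λ`; read it in `ι𝔭`, which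
  contains `ιL` and not `p`, and `b pⁿ ∉ ι𝔭` by `ChromaticCommonZeros.C_not_mem_of_natCast_p_not_mem`.)
* §2 `SharpFlatSelmerDualData.invol_mem_of_generatorShape_of_pow_mul_mem_charIdeal`: the same for
  `I = char D′.X`, any datum.
* §3 **`not_sprungSharpFlatLowerDivisibility_of_contraKato_of_unpairedZero`** (any `W/ℚ`, any `p`, any colour):
  given the leaf's own binders at ONE instance `(κ, γ, v, g, cneg, c, N, f, ϖ, L♯, L♭)`, ONE contragredient dual
  `D′ : SharpFlatSelmerDualData W κ γ⁻¹ …` with `∃ n, pⁿ L^• ∈ char D′.X` (= Sprung's Thm. 7.16 / Kato in the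
  natural keying, AS A HYPOTHESIS about this `D′`), and ONE prime `𝔭 ∌ p` with `L^• ∈ 𝔭`, `ι(L^•) ∉ 𝔭`
  (an `ι`-UNPAIRED zero), the typed leaf `SprungSharpFlatLowerDivisibility W p •` is FALSE. No f.g./torsion
  clause, no length, no dictionary hypothesis, no X8.
* §4 the X8 readings with a PRIVATE zero (`ChromaticIota.ClassX8.mem_and_mem_iff_sharp_iotaPair` / `…flat…`,
  input-free FE of the tree): `…_sharp_of_privateZero` (`L♯ ∈ 𝔭`, `L♭ ∉ 𝔭`, `𝔭 ∌ 3, T, Φ₃(1+T)`) and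
  `…_flat_of_privateZero` (`L♭ ∈ 𝔭`, `L♯ ∉ 𝔭`, `𝔭 ∌ 3, T`).

So the residual hypothesis of «typed 19875 is false in nature» is exactly: at ONE X8 pair, Sprung's printed
Thm. 7.16 for ONE naturally-keyed dual `X♯` (or `X♭`) and ONE private zero of that colour — the objects the x8
referee (R-228 §0) reads off the census generically; neither is constructible in the tree today.

References: Sprung, JNT 132 (2012) Def. 7.11, Thm. 7.16, Main Conj. 7.21 [Sprung2012]; Greenberg, LNM 1716 §1 p. 60
[GreenbergLNM1716]; Sprung, ANT 11 (2017) Thm. 4.13 / Cor. 4.14 [Sprung2017] (the FE behind §4, via the tree).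
-/

set_option linter.dupNamespace false
set_option autoImplicit false

noncomputable section

open scoped Classical NumberField MatrixGroups ModularForm

open NumberField IsDedekindDomain CongruenceSubgroup WeierstrassCurve PowerSeries
  Literature.NumberTheory.EllipticCurves Literature.NumberTheory.EllipticCurves.ModularForms
  Literature.NumberTheory.EllipticCurves.ZpExtension Literature.NumberTheory.EllipticCurves.Sprung2017
  Literature.NumberTheory.EllipticCurves.Sprung2012 Literature.NumberTheory.EllipticCurves.IwasawaAlgebra
  Literature.NumberTheory.EllipticCurves.Rank1Residual Literature.Barriers.BirchSwinnertonDyer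

namespace Summit.BirchSwinnertonDyer.BirchSwinnertonDyer.Theorems

namespace ChromaticKeying

universe u

/-! ## §1 `Λ`-algebra: an `ι`-crossed generator shape plus Kato's divisibility pairs the zeros of `L` -/

section Algebra

variable {p : ℕ} [Fact p.Prime]

/-- `p ∉ ι𝔭` iff `p ∉ 𝔭` (`ι` fixes constants). [cite: GreenbergLNM1716, §1 (p. 60)] -/
theorem natCast_p_not_mem_comap_invol (𝔭 : PrimeSpectrum (IwasawaAlgebra p))
    (hp𝔭 : (p : IwasawaAlgebra p) ∉ 𝔭.asIdeal) :
    (p : IwasawaAlgebra p) ∉ (PrimeSpectrum.comap (invol p).toRingHom 𝔭).asIdeal := by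
  rw [PrimeSpectrum.comap_asIdeal, Ideal.mem_comap]
  change invol p (p : IwasawaAlgebra p) ∉ 𝔭.asIdeal
  rwa [map_natCast]

/-- `f ∈ ι𝔭 ↔ ι f ∈ 𝔭` (unfolding). [cite: GreenbergLNM1716, §1 (p. 60)] -/
theorem mem_comap_invol_iff (𝔭 : PrimeSpectrum (IwasawaAlgebra p)) (f : IwasawaAlgebra p) :
    f ∈ (PrimeSpectrum.comap (invol p).toRingHom 𝔭).asIdeal ↔ invol p f ∈ 𝔭.asIdeal := by
  rw [PrimeSpectrum.comap_asIdeal, Ideal.mem_comap]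
  rfl

/-- `ι(L) = L(T^ι)` as a power-series substitution (the spelling of the tree's X8 functional-equation files;
`SignedKatoOffTwo.Invol.invol_eq_subst_invOnePlusSubOne`). [cite: GreenbergLNM1716, §1 (the involution)] -/
theorem invol_eq_subst (L : IwasawaAlgebra p) :
    invol p L = PowerSeries.subst (invOnePlusSubOne : IwasawaAlgebra p) L :=
  SignedKatoOffTwo.Invol.invol_eq_subst_invOnePlusSubOne p L

/-- Clearing the rational constant: from `gen^ℚ = C ϖ · M^ℚ` (`ϖ ∈ ℚ`) follows `C(den ϖ) · gen = C(num ϖ) · M`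
in `Λ`. [cite: Sprung2012, Def. 6.1 (p. 1495) (the period normalisation)] -/
theorem C_den_mul_eq_C_num_mul_of_eq {ϖ : ℚ} {gen M : IwasawaAlgebra p}
    (hgen : iwasawaToPowerSeries p gen = PowerSeries.C ((ϖ : ℚ) : ℚ_[p]) * iwasawaToPowerSeries p M) :
    PowerSeries.C (ϖ.den : ℤ_[p]) * gen = PowerSeries.C (ϖ.num : ℤ_[p]) * M := by
  have hrat : (ϖ.den : ℚ_[p]) * ((ϖ : ℚ) : ℚ_[p]) = (ϖ.num : ℚ_[p]) := by
    have h := congrArg (fun q : ℚ => (q : ℚ_[p])) (Rat.den_mul_eq_num ϖ)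
    push_cast at h
    exact h
  have hrat' : algebraMap ℤ_[p] ℚ_[p] (ϖ.den : ℤ_[p]) * ((ϖ : ℚ) : ℚ_[p]) =
      algebraMap ℤ_[p] ℚ_[p] (ϖ.num : ℤ_[p]) := by
    rwa [map_natCast, map_intCast]
  apply iwasawaToPowerSeries_injective p
  rw [map_mul, map_mul, hgen, ← mul_assoc, PowerSeries.map_C, PowerSeries.map_C, ← map_mul, hrat']

/-- **The crossed shape pairs the zeros of `L`.** If an ideal `I` has the door's contragredient generator shape
`I = (gen)`, `gen^ℚ = C ϖ · (ι L · h)^ℚ` (`ϖ ∈ ℚ`) AND Kato's divisibility `pⁿ L ∈ I`, then at every prime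
`𝔭 ∌ p`: `L ∈ 𝔭 ⟹ ι L ∈ 𝔭` — every zero of `L` off `(p)` is `ι`-paired. Proof: `b pⁿ L = a · ιL · h · q` in
`Λ` (`ϖ = a/b`, `pⁿ L = q · gen`); in the prime `ι𝔭 ∋ ιL`, `∌ p`, the left side lies in `ι𝔭`, `C(b) ∉ ι𝔭`,
`pⁿ ∉ ι𝔭`, so `L ∈ ι𝔭`, i.e. `ι L ∈ 𝔭`. [cite: GreenbergLNM1716, §1 (p. 60)] [cite: Sprung2012, Thm. 7.16 and Main Conj. 7.21 (the shapes only)] -/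
theorem invol_mem_of_generatorShape_of_pow_mul_mem {ϖ : ℚ} {L gen h : IwasawaAlgebra p}
    {I : Ideal (IwasawaAlgebra p)} {n : ℕ} (hI : I = Ideal.span {gen})
    (hgen : iwasawaToPowerSeries p gen =
      PowerSeries.C ((ϖ : ℚ) : ℚ_[p]) * iwasawaToPowerSeries p (invol p L * h))
    (hKato : (p : IwasawaAlgebra p) ^ n * L ∈ I)
    (𝔭 : PrimeSpectrum (IwasawaAlgebra p)) (hp𝔭 : (p : IwasawaAlgebra p) ∉ 𝔭.asIdeal)
    (hL : L ∈ 𝔭.asIdeal) : invol p L ∈ 𝔭.asIdeal := by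
  rw [hI] at hKato
  obtain ⟨q, hq⟩ := Ideal.mem_span_singleton'.mp hKato
  -- `C(den) · pⁿ L = C(num) · (ι L · h · q)` in `Λ`
  have hrel : PowerSeries.C (ϖ.den : ℤ_[p]) * ((p : IwasawaAlgebra p) ^ n * L) =
      PowerSeries.C (ϖ.num : ℤ_[p]) * (invol p L * h * q) := by
    have h1 : PowerSeries.C (ϖ.den : ℤ_[p]) * gen = PowerSeries.C (ϖ.num : ℤ_[p]) * (invol p L * h) :=
      C_den_mul_eq_C_num_mul_of_eq hgen
    calc PowerSeries.C (ϖ.den : ℤ_[p]) * ((p : IwasawaAlgebra p) ^ n * L)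
        = PowerSeries.C (ϖ.den : ℤ_[p]) * gen * q := by rw [← hq]; ring
      _ = PowerSeries.C (ϖ.num : ℤ_[p]) * (invol p L * h) * q := by rw [h1]
      _ = PowerSeries.C (ϖ.num : ℤ_[p]) * (invol p L * h * q) := by ring
  -- read it in `ι𝔭`
  set 𝔮 := PrimeSpectrum.comap (invol p).toRingHom 𝔭 with h𝔮def
  have hp𝔮 : (p : IwasawaAlgebra p) ∉ 𝔮.asIdeal := natCast_p_not_mem_comap_invol 𝔭 hp𝔭
  have hιL𝔮 : invol p L ∈ 𝔮.asIdeal := by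
    rw [h𝔮def, mem_comap_invol_iff, invol_invol]; exact hL
  have hrhs : PowerSeries.C (ϖ.num : ℤ_[p]) * (invol p L * h * q) ∈ 𝔮.asIdeal :=
    𝔮.asIdeal.mul_mem_left _ (𝔮.asIdeal.mul_mem_right _ (𝔮.asIdeal.mul_mem_right _ hιL𝔮))
  rw [← hrel] at hrhs
  have hden : (ϖ.den : ℤ_[p]) ≠ 0 := by exact_mod_cast ϖ.den_nz
  rcases 𝔮.isPrime.mem_or_mem hrhs with hC | hpL
  · exact absurd hC (ChromaticCommonZeros.C_not_mem_of_natCast_p_not_mem hden 𝔮 hp𝔮)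
  · rcases 𝔮.isPrime.mem_or_mem hpL with hpn | hL𝔮
    · exact absurd (𝔮.isPrime.mem_of_pow_mem n hpn) hp𝔮
    · rw [h𝔮def, mem_comap_invol_iff] at hL𝔮
      exact hL𝔮

/-- `∃`-packaged form of `invol_mem_of_generatorShape_of_pow_mul_mem` (the door's output and Kato's output as
they come). [cite: GreenbergLNM1716, §1 (p. 60)] -/
theorem invol_mem_of_exists_generatorShape_of_exists_pow_mul_mem {ϖ : ℚ} {L : IwasawaAlgebra p}
    {I : Ideal (IwasawaAlgebra p)}
    (hshape : ∃ gen h : IwasawaAlgebra p, I = Ideal.span {gen} ∧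
      iwasawaToPowerSeries p gen =
        PowerSeries.C ((ϖ : ℚ) : ℚ_[p]) * iwasawaToPowerSeries p (invol p L * h))
    (hKato : ∃ n : ℕ, (p : IwasawaAlgebra p) ^ n * L ∈ I)
    (𝔭 : PrimeSpectrum (IwasawaAlgebra p)) (hp𝔭 : (p : IwasawaAlgebra p) ∉ 𝔭.asIdeal)
    (hL : L ∈ 𝔭.asIdeal) : invol p L ∈ 𝔭.asIdeal := by
  obtain ⟨gen, h, hI, hgen⟩ := hshape
  obtain ⟨n, hn⟩ := hKato
  exact invol_mem_of_generatorShape_of_pow_mul_mem hI hgen hn 𝔭 hp𝔭 hL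

end Algebra

/-! ## §2 Per datum: the crossed shape on `char D′.X` plus Kato pairs the zeros of `L` -/

section Data

variable {K : Type u} [Field K] [NumberField K] {W : WeierstrassCurve K} {p : ℕ} [Fact p.Prime]
  {κ : ZpExtension K p} {E : Type u} [Field E] [Algebra K E]
  {ιv : AlgebraicClosure K →ₐ[K] AlgebraicClosure E} {ap : ℤ} {g : Field.absoluteGaloisGroup E}
  {c : ℕ → localPoints W E} {col : Chroma} {γ : Field.absoluteGaloisGroup K}

/-- **Per datum.** If a ♯/♭ dual datum `D′` (any key) has `char D′.X = (gen)` with `gen^ℚ = C ϖ · (ι L · h)^ℚ`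
and `pⁿ L ∈ char D′.X` for some `n`, then every zero of `L` off `(p)` is `ι`-paired: `L ∈ 𝔭 ⟹ ι L ∈ 𝔭`.
[cite: GreenbergLNM1716, §1 (p. 60)] [cite: Sprung2012, Thm. 7.16 and Main Conj. 7.21 (the shapes only)] -/
theorem SharpFlatSelmerDualData.invol_mem_of_generatorShape_of_pow_mul_mem_charIdeal
    (D' : SharpFlatSelmerDualData W κ γ ιv ap g c col) {ϖ : ℚ} {L : IwasawaAlgebra p}
    (hshape : ∃ gen h : IwasawaAlgebra p, D'.charIdeal = Ideal.span {gen} ∧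
      iwasawaToPowerSeries p gen =
        PowerSeries.C ((ϖ : ℚ) : ℚ_[p]) * iwasawaToPowerSeries p (invol p L * h))
    (hKato : ∃ n : ℕ, (p : IwasawaAlgebra p) ^ n * L ∈ D'.charIdeal)
    (𝔭 : PrimeSpectrum (IwasawaAlgebra p)) (hp𝔭 : (p : IwasawaAlgebra p) ∉ 𝔭.asIdeal)
    (hL : L ∈ 𝔭.asIdeal) : invol p L ∈ 𝔭.asIdeal :=
  invol_mem_of_exists_generatorShape_of_exists_pow_mul_mem hshape hKato 𝔭 hp𝔭 hL

end Data

/-! ## §3 The fact-free per-pair negative for the typed leaf -/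

section Leaf

variable (W : WeierstrassCurve ℚ) [W.IsElliptic] [W.IsGloballyMinimal] (p : ℕ) [Fact p.Prime] (col : Chroma)

/-- **FACT-FREE PER-PAIR NEGATIVE FOR THE TYPED K1 LEAF.** Fix `(W, p, •)` and ONE instance of the leaf's own
binders (`κ` cyclotomic with generator `γ` and cyclotomic variable, `v ∣ p`, local lift `g`, Honda system
`(cneg, c)`, newform `f` of level `N`, period ratio `ϖ`, Sprung pair `(L♯, L♭)` with `L^• ≠ 0`). Suppose ONE
CONTRAGREDIENT dual `D′ : SharpFlatSelmerDualData W κ γ⁻¹ …` satisfies Kato's print divisibility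
`∃ n, pⁿ L^• ∈ char D′.X` (the natural-keying reading of Sprung's Thm. 7.16 — a HYPOTHESIS here), and some prime
`𝔭 ∌ p` of `Λ` is an `ι`-UNPAIRED zero of `L^•` (`L^• ∈ 𝔭`, `ι(L^•) ∉ 𝔭`). Then the typed leaf
`Theorems.SprungSharpFlatLowerDivisibility W p •` is false: by the keying door it would give `char D′.X = (gen)`,
`gen^ℚ = ϖ · (ι(L^•) · h)^ℚ`, and §2 would pair the zero. No named fact is used; nothing is refuted (the
hypotheses are displayed, unconstructed binders). [cite: Sprung2012, Thm. 7.16 (p. 1504) and Main Conj. 7.21 (p. 1505) (the shapes only)]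
[cite: GreenbergLNM1716, §1 (p. 60)] -/
theorem not_sprungSharpFlatLowerDivisibility_of_contraKato_of_unpairedZero
    (κ : ZpExtension ℚ p) (γ : Field.absoluteGaloisGroup ℚ)
    (hcyc : κ.IsCyclotomic) (htop : κ.IsTopGenerator γ) (hvar : IsCyclotomicVariable p γ)
    (v : HeightOneSpectrum (𝓞 ℚ)) (hv : (p : 𝓞 ℚ) ∈ v.asIdeal)
    (g : Field.absoluteGaloisGroup (v.adicCompletion ℚ))
    (hg : κ.IsTopGenerator (resGalOfEmb (closureEmb (K := ℚ) (v.adicCompletion ℚ)) g))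
    (cneg : localPoints W (v.adicCompletion ℚ)) (c : ℕ → localPoints W (v.adicCompletion ℚ))
    (hH : IsHondaSystem κ (closureEmb (K := ℚ) (v.adicCompletion ℚ)) W (W.frobeniusTrace p) g cneg c)
    (N : ℕ) (hN : NeZero N) (f : CuspForm (Gamma0 N) 2) (ϖ : ℚ) (Lsharp Lflat : IwasawaAlgebra p)
    (hnew : IsNewformOf W f) (hper : (ϖ : ℝ) * W.realPeriodRat = plusPeriod f)
    (hpair : IsSprungPair f p (W.frobeniusTrace p) Lsharp Lflat) (hne : chromaticL col Lsharp Lflat ≠ 0)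
    (D' : SharpFlatSelmerDualData W κ γ⁻¹ (closureEmb (K := ℚ) (v.adicCompletion ℚ))
      (W.frobeniusTrace p) g c col)
    (hKato : ∃ n : ℕ, (p : IwasawaAlgebra p) ^ n * chromaticL col Lsharp Lflat ∈ D'.charIdeal)
    (𝔭 : PrimeSpectrum (IwasawaAlgebra p)) (hp𝔭 : (p : IwasawaAlgebra p) ∉ 𝔭.asIdeal)
    (hL : chromaticL col Lsharp Lflat ∈ 𝔭.asIdeal)
    (hιL : invol p (chromaticL col Lsharp Lflat) ∉ 𝔭.asIdeal) :
    ¬ SprungSharpFlatLowerDivisibility W p col := by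
  intro hleaf
  have hshape := (sprungSharpFlatLowerDivisibility_iff_contra_invol W p col).1 hleaf κ γ hcyc htop hvar v hv
    g hg cneg c hH N hN f ϖ Lsharp Lflat hnew hper hpair hne D'
  exact hιL (SharpFlatSelmerDualData.invol_mem_of_generatorShape_of_pow_mul_mem_charIdeal D' hshape hKato
    𝔭 hp𝔭 hL)

/-- **X8, colour ♯, PRIVATE zero.** On an X8 pair `(W, 3)`: one contragredient `X♯`-datum with `∃ n, 3ⁿ L♯ ∈ char`,
and one prime `𝔭 ∌ 3, T, Φ₃(1+T)` with `L♯ ∈ 𝔭`, `L♭ ∉ 𝔭` (a PRIVATE zero of `L♯`) ⟹ the typed leaf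
`SprungSharpFlatLowerDivisibility W 3 ♯` is false. (A private zero off the three primes is `ι`-unpaired by the
tree's input-free FE `ChromaticIota.ClassX8.flat_mem_of_sharp_mem_of_subst_sharp_mem`.) This is KEYING-g5 §2
with conjuncts (i), (iii) and the finiteness/torsion clauses GONE. [cite: Sprung2017, Thm. 4.13 and Cor. 4.14]
[cite: Sprung2012, Thm. 7.16 (p. 1504) and Main Conj. 7.21 (p. 1505) (the shapes only)] -/
theorem not_sprungSharpFlatLowerDivisibility_sharp_of_contraKato_of_privateZero (hX : ClassX8 W p)
    (κ : ZpExtension ℚ p) (γ : Field.absoluteGaloisGroup ℚ)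
    (hcyc : κ.IsCyclotomic) (htop : κ.IsTopGenerator γ) (hvar : IsCyclotomicVariable p γ)
    (v : HeightOneSpectrum (𝓞 ℚ)) (hv : (p : 𝓞 ℚ) ∈ v.asIdeal)
    (g : Field.absoluteGaloisGroup (v.adicCompletion ℚ))
    (hg : κ.IsTopGenerator (resGalOfEmb (closureEmb (K := ℚ) (v.adicCompletion ℚ)) g))
    (cneg : localPoints W (v.adicCompletion ℚ)) (c : ℕ → localPoints W (v.adicCompletion ℚ))
    (hH : IsHondaSystem κ (closureEmb (K := ℚ) (v.adicCompletion ℚ)) W (W.frobeniusTrace p) g cneg c)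
    (N : ℕ) (hN : NeZero N) (f : CuspForm (Gamma0 N) 2) (ϖ : ℚ) (Lsharp Lflat : IwasawaAlgebra p)
    (hnew : IsNewformOf W f) (hper : (ϖ : ℝ) * W.realPeriodRat = plusPeriod f)
    (hpair : IsSprungPair f p (W.frobeniusTrace p) Lsharp Lflat)
    (D' : SharpFlatSelmerDualData W κ γ⁻¹ (closureEmb (K := ℚ) (v.adicCompletion ℚ))
      (W.frobeniusTrace p) g c Chroma.sharp)
    (hKato : ∃ n : ℕ, (p : IwasawaAlgebra p) ^ n * Lsharp ∈ D'.charIdeal)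
    (𝔭 : PrimeSpectrum (IwasawaAlgebra p)) (hp𝔭 : (p : IwasawaAlgebra p) ∉ 𝔭.asIdeal)
    (hT : (PowerSeries.X : IwasawaAlgebra p) ∉ 𝔭.asIdeal)
    (hΦ : ((1 + PowerSeries.X : IwasawaAlgebra p) ^ 2 + (1 + PowerSeries.X) + 1) ∉ 𝔭.asIdeal)
    (hLs : Lsharp ∈ 𝔭.asIdeal) (hLf : Lflat ∉ 𝔭.asIdeal) :
    ¬ SprungSharpFlatLowerDivisibility W p Chroma.sharp := by
  haveI : NeZero N := hN
  have hne : chromaticL Chroma.sharp Lsharp Lflat ≠ 0 :=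
    ChromaticBothColours.ClassX8.chromaticL_ne_zero W p hX f Lsharp Lflat hnew hpair Chroma.sharp
  have hιL : invol p (chromaticL Chroma.sharp Lsharp Lflat) ∉ 𝔭.asIdeal := by
    rw [chromaticL_sharp, invol_eq_subst]
    intro hι
    exact hLf (ChromaticIota.ClassX8.flat_mem_of_sharp_mem_of_subst_sharp_mem W p hX f hnew Lsharp Lflat
      hpair 𝔭.asIdeal 𝔭.isPrime hp𝔭 hT hΦ hLs hι)
  have hKato' : ∃ n : ℕ, (p : IwasawaAlgebra p) ^ n * chromaticL Chroma.sharp Lsharp Lflat ∈ D'.charIdeal := by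
    rw [chromaticL_sharp]; exact hKato
  have hL : chromaticL Chroma.sharp Lsharp Lflat ∈ 𝔭.asIdeal := by rw [chromaticL_sharp]; exact hLs
  exact not_sprungSharpFlatLowerDivisibility_of_contraKato_of_unpairedZero W p Chroma.sharp κ γ hcyc htop hvar
    v hv g hg cneg c hH N hN f ϖ Lsharp Lflat hnew hper hpair hne D' hKato' 𝔭 hp𝔭 hL hιL

/-- **X8, colour ♭, PRIVATE zero.** On an X8 pair `(W, 3)`: one contragredient `X♭`-datum with `∃ n, 3ⁿ L♭ ∈ char`,
and one prime `𝔭 ∌ 3, T` with `L♭ ∈ 𝔭`, `L♯ ∉ 𝔭` (a PRIVATE zero of `L♭`) ⟹ the typed leaf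
`SprungSharpFlatLowerDivisibility W 3 ♭` is false (FE: `ChromaticIota.ClassX8.sharp_mem_of_flat_mem_of_subst_flat_mem`).
[cite: Sprung2017, Thm. 4.13 and Cor. 4.14] [cite: Sprung2012, Thm. 7.16 (p. 1504) and Main Conj. 7.21 (p. 1505) (the shapes only)] -/
theorem not_sprungSharpFlatLowerDivisibility_flat_of_contraKato_of_privateZero (hX : ClassX8 W p)
    (κ : ZpExtension ℚ p) (γ : Field.absoluteGaloisGroup ℚ)
    (hcyc : κ.IsCyclotomic) (htop : κ.IsTopGenerator γ) (hvar : IsCyclotomicVariable p γ)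
    (v : HeightOneSpectrum (𝓞 ℚ)) (hv : (p : 𝓞 ℚ) ∈ v.asIdeal)
    (g : Field.absoluteGaloisGroup (v.adicCompletion ℚ))
    (hg : κ.IsTopGenerator (resGalOfEmb (closureEmb (K := ℚ) (v.adicCompletion ℚ)) g))
    (cneg : localPoints W (v.adicCompletion ℚ)) (c : ℕ → localPoints W (v.adicCompletion ℚ))
    (hH : IsHondaSystem κ (closureEmb (K := ℚ) (v.adicCompletion ℚ)) W (W.frobeniusTrace p) g cneg c)
    (N : ℕ) (hN : NeZero N) (f : CuspForm (Gamma0 N) 2) (ϖ : ℚ) (Lsharp Lflat : IwasawaAlgebra p)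
    (hnew : IsNewformOf W f) (hper : (ϖ : ℝ) * W.realPeriodRat = plusPeriod f)
    (hpair : IsSprungPair f p (W.frobeniusTrace p) Lsharp Lflat)
    (D' : SharpFlatSelmerDualData W κ γ⁻¹ (closureEmb (K := ℚ) (v.adicCompletion ℚ))
      (W.frobeniusTrace p) g c Chroma.flat)
    (hKato : ∃ n : ℕ, (p : IwasawaAlgebra p) ^ n * Lflat ∈ D'.charIdeal)
    (𝔭 : PrimeSpectrum (IwasawaAlgebra p)) (hp𝔭 : (p : IwasawaAlgebra p) ∉ 𝔭.asIdeal)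
    (hT : (PowerSeries.X : IwasawaAlgebra p) ∉ 𝔭.asIdeal)
    (hLf : Lflat ∈ 𝔭.asIdeal) (hLs : Lsharp ∉ 𝔭.asIdeal) :
    ¬ SprungSharpFlatLowerDivisibility W p Chroma.flat := by
  haveI : NeZero N := hN
  have hne : chromaticL Chroma.flat Lsharp Lflat ≠ 0 :=
    ChromaticBothColours.ClassX8.chromaticL_ne_zero W p hX f Lsharp Lflat hnew hpair Chroma.flat
  have hιL : invol p (chromaticL Chroma.flat Lsharp Lflat) ∉ 𝔭.asIdeal := by
    rw [chromaticL_flat, invol_eq_subst]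
    intro hι
    exact hLs (ChromaticIota.ClassX8.sharp_mem_of_flat_mem_of_subst_flat_mem W p hX f hnew Lsharp Lflat
      hpair 𝔭.asIdeal 𝔭.isPrime hp𝔭 hT hLf hι)
  have hKato' : ∃ n : ℕ, (p : IwasawaAlgebra p) ^ n * chromaticL Chroma.flat Lsharp Lflat ∈ D'.charIdeal := by
    rw [chromaticL_flat]; exact hKato
  have hL : chromaticL Chroma.flat Lsharp Lflat ∈ 𝔭.asIdeal := by rw [chromaticL_flat]; exact hLf
  exact not_sprungSharpFlatLowerDivisibility_of_contraKato_of_unpairedZero W p Chroma.flat κ γ hcyc htop hvar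
    v hv g hg cneg c hH N hN f ϖ Lsharp Lflat hnew hper hpair hne D' hKato' 𝔭 hp𝔭 hL hιL

end Leaf

end ChromaticKeying

end Summit.BirchSwinnertonDyer.BirchSwinnertonDyer.Theorems

end
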